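import Literature.MathematicalPhysics.QuantumFieldTheory.Balaban1983to89.B9Eq3132NuReading
import Literature.MathematicalPhysics.QuantumFieldTheory.Balaban1983to89.B6QGQCoerciveKLevelV1

/-!
# `Balaban1983to89.B9Eq3132NuReadingAtOne` — [Balaban1985BackgroundPropagators] (3.132) p. 422 AT `U = 1` FOR THE REPAIRED (`ν`-WEIGHTED) READING:
# ROW 26's INEQUALITY IS A **THEOREM** at `U = 1` — Cor. 3.5's «for U = 1 these theorems are proved in [4]» for `(QGQ*)⁻¹`, `(QG₁Q*)⁻¹`, from
# [4] Prop. 2.7 (2.149) with its coercivity (2.147) DISCHARGED in the tree (`B6QGQCoerciveKLevelV1.prop27_kLevel_unconditional`)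

statement-level skeleton of published theorems with citation tags; proofs where landed; nothing here is a claim about the Yang–Mills mass gap

THE PRINT.  [B9] Cor. 3.5 p. 407: *«for U = 1 these theorems are proved in [4]»*; (3.132) p. 422.  [4] = [Balaban1984PropagatorsII] Prop. 2.7 (2.149) p. 249:
*«|(QGQ\*)⁻¹(b, b′)| ≤ O(1)(Lʲη)^{d−2}η⁻²e^{−δ₄d(b,b′)}»*, (2.147) p. 248 *«⟨B,(QGQ\*)B⟩ ≥ γ₀‖B‖²»*, Lemma 2.1 (2.60) p. 234.

## WHAT IS PROVED (sorry-free, 0 `def`, standard axioms)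

* §5 `siteKernelOfOp_ker_le_abs_entry` (the flat reading of a lifted letter is at most its flat entry; two private folklore helpers);
  ★★★ **`ineq3132Nu_one`**: for every family index with `4 ≤ ℓ`, band `0 < b₀ ≤ b₁`, every `𝔸`, `G`, `dd`, and every letters family `T x` with
  `T x 1 = (onFun EE)♯` (r03's `(QGQ*)⁻¹` of [4] (2.35)): `∃ M₆ C δ, 0 < C ∧ 0 < δ ∧ ∀ x, M₆ ≤ M_x → B9.Ineq3132 dd (siteKernelOfOpNu … (nuY dd …) (T x)) C δ 1`.
  Proof: `prop27_kLevel_unconditional` (`|⟪e_y, EE e_{y′}⟫| ≤ Λ_y⁻¹Λ_{y′}⁻¹(2∕γ₀)e^{−δ₄d}`, every side condition a `KIdx` field or an `M`-threshold), the reading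
  bound `kerν ≤ ν(y)ν(y′)|⟪e_y, EE e_{y′}⟫|`, `ν·Λ⁻¹ = (Lʲη)^{−(1+dd∕2)}`, and n06-i g2's (2.60) transfer `weightsTransfer_symm_geo9Y` at rate `δ₄∕2`
  (`C = (2∕γ₀)·L^{|dd−2|∕2}`, `δ = δ₄∕2`).
* §6 ★★★ **`ineq3132Nu_opsYNuOfRecordV4E_one (θ) (hℓ : 4 ≤ θ.ℓ₆) (M⋆ 𝔯 𝔢 𝔴 𝔈)`**: at the repaired instance of record
  (`B9Eq3132NuReading.opsYNuOfRecordV4E`) BOTH row-26 inequalities hold at `U = 1` for every member above a threshold — the `U = 1` clauses are def-Y's `CovLettersY`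
  fields (`QGQinvY_one_liftEndY`, n06-i g5) and `(QG₁Q*)⁻¹(1) = (QGQ*)⁻¹(1)` (def-Y `QG1QinvY_one`, `(𝔯 x).Δ2_one`).
So the repaired row-26 face (`B9Eq3132NuReading.s3132Nu_opsYNuOfRecordV4E`: four Λ-normalised binders) is NON-VACUOUS in the strong sense: its conclusion
is TRUE at `U = 1`, and its binders are [4]-true there ((2.142), (2.147), in the tree) — contrast `B9Eq3132FlatReadingAtRecord.coercive_decay_false_opsYOfRecordDE`.

HONEST SCOPE.  [4]-at-`U = 1` only (all inputs PROVED in the tree); nothing of [B9] at `U ≠ 1` is asserted; COUNT-NEUTRAL; N06 NOT discharged; one finite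
𝕋^{d+1} programme — nothing continuum ∕ OS ∕ mass-gap ∕ Clay.  Cell `pub-ymgap` (HUMAN RULING D-0062), node N06 [B9], seat `pub-ymgap-dag-n06-i` (harness
re-seat gen 7), 2026-08-27.  A NEW file; nothing landed is modified.
-/

namespace Literature.MathematicalPhysics.QuantumFieldTheory.Balaban1983to89.B9Eq3132NuReadingAtOne

open Node00
open scoped InnerProductSpace
open B6KLevelCensusIndexV1 (KIdx)
open B6SectAOperatorsV1 (BondIdx BondIdxSpace)
open B6SectAVectorModelV1 (EE)
open B6Ineq2142KLevelV1 (lvl β)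
open B6Prop27KLevelV1 (wt wt_pos lam lam_pos lam_sq)
open B6GlobalChartV1 (PV domT)
open B6MultiLevelBoxOperator (N0)
open B6MultiLevelTorusOperator (TDomains)
open B6Ineq2133TwoScaleV1 (onFun onFun_apply)
open B9PinMembersKLevelV1 (MemberY geo9Y bg9Y)
open B9GeoLemma21KLevelV1 (geo9Y_len_pos weightsTransfer_symm_geo9Y symmA_pos)
open B9Eq3132NuReading (siteKernelOfOpNu siteKernelOfOpNu_ker siteKernelOfOpNu_ker_nonneg lamY lamY_pos lamInvY nuY nuY_pos nuY_mul_lamInvY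
  opsYNuOfLetters opsYNuOfRecordV4E)

noncomputable section

variable {𝔸 : Type} [NormedRing 𝔸] [NormedAlgebra ℂ 𝔸] [CompleteSpace 𝔸]
variable {d ℓ : ℕ} {hd : 1 ≤ d + 1} {hL : Odd (ℓ + 1) ∧ 1 < ℓ + 1} {b₀ b₁ : ℝ} {Mstar : ℕ}

/-! ## §5 ★★★ The repaired row at `U = 1` is a THEOREM: [4] Prop. 2.7 (2.149) (unconditional in the tree) for the `ν`-reading -/

section AtOne

variable (G : Subgroup 𝔸ˣ)

omit [CompleteSpace 𝔸] in
/-- the lift of a real endomorphism on a flat delta: `(S♯(δ_{b′} ⊗ E))(b) = S(b, b′) • E`. [folklore] -/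
private theorem liftEndY_deltaY_apply {X : Type} [Fintype X] [DecidableEq X] (S : Module.End ℝ (X → ℝ)) (b b' : X) (E : 𝔸) :
    liftEndY 𝔸 S (deltaY b' E) b = (((LinearMap.toMatrix' S) b b' : ℝ) : ℂ) • E := by
  have hδ : deltaY b' E = liftY (Pi.single b' (1 : ℝ)) E := by
    funext z
    by_cases h : z = b'
    · subst h; simp [deltaY, liftY]
    · simp [deltaY, liftY, h]
  rw [hδ, liftEndY_liftY, liftY_apply, LinearMap.toMatrix'_apply]

/-- the flat matrix entry of `onFun S` IS `⟪e_b, S e_{b′}⟫`. [folklore] -/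
private theorem toMatrix'_onFun_apply {ι : Type} [Fintype ι] [DecidableEq ι] (S : EuclideanSpace ℝ ι →ₗ[ℝ] EuclideanSpace ℝ ι) (b b' : ι) :
    LinearMap.toMatrix' (onFun S) b b' = ⟪EuclideanSpace.single b (1 : ℝ), S (EuclideanSpace.single b' (1 : ℝ))⟫_ℝ := by
  rw [LinearMap.toMatrix'_apply, EuclideanSpace.inner_single_left, onFun_apply]
  simp only [map_one, one_mul]
  rfl

/-- **THE FLAT READING OF A LIFTED LETTER IS AT MOST ITS FLAT ENTRY**: `sup_{‖E‖ ≤ 1} ‖S♯(δ_{b′}⊗E)(b)‖ ≤ |S(b,b′)|`.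
[cite: Balaban1985BackgroundPropagators, (3.132) p.422 (the reading), bookkeeping] -/
theorem siteKernelOfOp_ker_le_abs_entry (i : KIdx d ℓ hd hL b₀ b₁) (B : B9.Backgrounds) (cfg : B.Cfg → CfgY 𝔸 i)
    (O : CfgY 𝔸 i → (IBondY i → 𝔸) →ₗ[ℂ] (IBondY i → 𝔸)) (U : B.Cfg) (S : Module.End ℝ (IBondY i → ℝ))
    (hO : O (cfg U) = liftEndY 𝔸 S) (b b' : IBondY i) :
    (siteKernelOfOp i B cfg O id id).ker U b b' ≤ |LinearMap.toMatrix' S b b'| := by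
  show (⨆ E : BallY 𝔸, ‖O (cfg U) (deltaY b' (E : 𝔸)) b‖) ≤ |LinearMap.toMatrix' S b b'|
  haveI : Nonempty (BallY 𝔸) := ballY_nonempty
  refine ciSup_le fun E => ?_
  rw [hO, liftEndY_deltaY_apply, norm_smul, Complex.norm_real, Real.norm_eq_abs]
  exact mul_le_of_le_one_right (abs_nonneg _) (mem_closedBall_zero_iff.1 E.2)

/-- ★★★ **ROW 26's INEQUALITY (3.132) AT `U = 1` FOR THE `ν`-READING IS PROVED** ([B9] Cor. 3.5: «for U = 1 these theorems are proved in [4]»): for every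
letters family `T x` whose `U = 1` value is `(onFun EE)♯` (r03's `(QGQ*)⁻¹` of [4] (2.35)) there are `M₆`, `C > 0`, `δ > 0` such that for every member with
`M ≥ M₆`, `B9.Ineq3132 dd (ν-reading of T x) C δ 1`.  Proof: [4] Prop. 2.7 (2.149) at k levels WITH ITS COERCIVITY (2.147) DISCHARGED
(`B6QGQCoerciveKLevelV1.prop27_kLevel_unconditional`): `|⟪e_y, EE e_{y′}⟫| ≤ Λ_y⁻¹Λ_{y′}⁻¹(2∕γ₀)e^{−δ₄d}`, so the `ν`-reading is `≤ (len_y len_{y′})^{−(1+dd∕2)}(2∕γ₀)e^{−δ₄d}`,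
and n06-i g2's (2.60) transfer (`weightsTransfer_symm_geo9Y`, «for M large») turns the symmetric weights into print's `(Lʲη)⁻²(L^{j′}η)^{−dd}` at the cost `e^{(δ₄∕2)d}`.
[cite: Balaban1985BackgroundPropagators, (3.132) p.422, Cor. 3.5 p.407; Balaban1984PropagatorsII, Prop. 2.7 (2.149) p.249, (2.147) p.248, Lemma 2.1 (2.60) p.234] -/
theorem ineq3132Nu_one (hℓ : 4 ≤ ℓ) (hb₀ : 0 < b₀) (hb₁ : b₀ ≤ b₁) (dd : ℕ)
    (T : ∀ x : MemberY d ℓ hd hL b₀ b₁ Mstar, CfgY 𝔸 x.toKIdx → ((IBondY x.toKIdx → 𝔸) →ₗ[ℂ] (IBondY x.toKIdx → 𝔸)))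
    (hT1 : ∀ x : MemberY d ℓ hd hL b₀ b₁ Mstar, T x (fun _ _ => 1) = liftEndY 𝔸 (onFun (EE (domT x.hN x.D x.hk) x.hcf x.hw))) :
    ∃ M₆ C δ : ℝ, 0 < C ∧ 0 < δ ∧ ∀ x : MemberY d ℓ hd hL b₀ b₁ Mstar, M₆ ≤ (geo9Y x).M →
      B9.Ineq3132 dd (siteKernelOfOpNu x.toKIdx (bg9Y 𝔸 G x) (fun U => U) (nuY dd x.toKIdx) (T x)) C δ (bg9Y 𝔸 G x).one := by
  -- [4] Prop. 2.7 unconditional: constants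
  obtain ⟨σ₁, hσ₁, h27⟩ := B6QGQCoerciveKLevelV1.prop27_kLevel_unconditional d ℓ hd hL hb₀ hb₁
  obtain ⟨A', M₂, c, N₁, hA', hM₂, hc, H27⟩ := h27 σ₁ hσ₁ le_rfl (1 / 2) (by norm_num) (by norm_num)
  set δ₃ : ℝ := B6RandomWalk.delta3 (1 / 2) (2 * σ₁) with hδ₃
  have hδ₃pos : 0 < δ₃ := B6RandomWalk.delta3_pos (by norm_num) (by linarith)
  set γ₀ : ℝ := B6QGQCoerciveKLevelV1.gam0 d ℓ b₁ with hγ₀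
  have hγ₀ : 0 < γ₀ := B6QGQCoerciveKLevelV1.gam0_pos d ℓ (le_trans hb₀.le hb₁)
  set δ₄ : ℝ := min (δ₃ / 4) (γ₀ / A' / (2 * (1 * (4 / δ₃) * (2 * ((d : ℝ) + 1) * c)) + 1)) with hδ₄
  have hδ₄pos : 0 < δ₄ := by
    refine lt_min (by positivity) (div_pos (div_pos hγ₀ hA') ?_)
    have : 0 ≤ 2 * (1 * (4 / δ₃) * (2 * ((d : ℝ) + 1) * c)) := by positivity
    linarith
  -- the (2.60) transfer at rate δ₄/2
  obtain ⟨Mw, hMw⟩ := weightsTransfer_symm_geo9Y (d := d) (ℓ := ℓ) (hd := hd) (hL := hL) (b₀ := b₀) (b₁ := b₁) (Mstar := Mstar) dd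
    (half_pos hδ₄pos)
  set A : ℝ := (((ℓ + 1 : ℕ) : ℝ)) ^ |((dd : ℝ) - 2) / 2| with hA
  have hApos : 0 < A := symmA_pos (ℓ := ℓ) dd
  refine ⟨max M₂ (max Mw ((N₁ : ℝ) + 1)), 2 / γ₀ * A, δ₄ / 2, by positivity, half_pos hδ₄pos, fun x hM y y' => ?_⟩
  -- the side conditions of Prop. 2.7 at the member
  have hMx : (geo9Y x).M = ((ℓ + 1 : ℕ) : ℝ) * (x.Mh : ℝ) := rfl
  have hM₂x : M₂ ≤ ((ℓ : ℝ) + 1) * (x.Mh : ℝ) := by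
    have h := le_trans (le_max_left _ _) hM; rw [hMx] at h; push_cast at h; exact h
  have hN₁x : N₁ + 1 ≤ x.R * ((ℓ + 1) * x.Mh) := by
    have h := le_trans (le_max_right _ _) (le_trans (le_max_right _ _) hM)
    rw [hMx] at h
    have h' : N₁ + 1 ≤ (ℓ + 1) * x.Mh := by exact_mod_cast h
    have hR1 : 1 ≤ x.R := le_trans (Nat.one_le_two_pow.trans (by nlinarith [x.hR2] : 2 ^ 1 ≤ x.R)) le_rfl
    calc N₁ + 1 ≤ (ℓ + 1) * x.Mh := h'
      _ = 1 * ((ℓ + 1) * x.Mh) := (one_mul _).symm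
      _ ≤ x.R * ((ℓ + 1) * x.Mh) := Nat.mul_le_mul_right _ hR1
  have h149 := H27 x.m x.K x.hN x.D x.hk x.hk2 x.hMha x.hM8 x.hR2 x.hP5 x.hℓ x.hpl hM₂x hN₁x x.hcf x.hw x.hwb y y'
  -- the reading at `U = 1` is at most `ν ν′ |⟪e_y, EE e_{y′}⟫|`
  have hone : (bg9Y 𝔸 G x).one = fun _ _ => 1 := rfl
  have hflat := siteKernelOfOp_ker_le_abs_entry x.toKIdx (bg9Y 𝔸 G x) (fun U => U) (T x) (bg9Y 𝔸 G x).one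
    (onFun (EE (domT x.hN x.D x.hk) x.hcf x.hw)) (by rw [hone]; exact hT1 x) y y'
  rw [toMatrix'_onFun_apply] at hflat
  have hνy := nuY_pos dd x.toKIdx y
  have hνy' := nuY_pos dd x.toKIdx y'
  have hker : (siteKernelOfOpNu x.toKIdx (bg9Y 𝔸 G x) (fun U => U) (nuY dd x.toKIdx) (T x)).ker (bg9Y 𝔸 G x).one y y' ≤
      nuY dd x.toKIdx y * nuY dd x.toKIdx y' * ((lamY x.toKIdx y)⁻¹ * (lamY x.toKIdx y')⁻¹ * (2 / γ₀ *
        Real.exp (-(δ₄ * (geo9Y x).dist y y')))) := by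
    rw [siteKernelOfOpNu_ker]
    exact mul_le_mul_of_nonneg_left (hflat.trans h149) (mul_pos hνy hνy').le
  -- `ν ν′ Λ⁻¹ Λ′⁻¹ = w w′`, then the transfer
  have h1 : nuY dd x.toKIdx y * (lamY x.toKIdx y)⁻¹ = (geo9Y x).len y ^ (-(1 + (dd : ℝ) / 2)) := nuY_mul_lamInvY dd x.toKIdx y
  have h1' : nuY dd x.toKIdx y' * (lamY x.toKIdx y')⁻¹ = (geo9Y x).len y' ^ (-(1 + (dd : ℝ) / 2)) := nuY_mul_lamInvY dd x.toKIdx y'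
  have hww : nuY dd x.toKIdx y * nuY dd x.toKIdx y' * ((lamY x.toKIdx y)⁻¹ * (lamY x.toKIdx y')⁻¹) =
      (geo9Y x).len y ^ (-(1 + (dd : ℝ) / 2)) * (geo9Y x).len y' ^ (-(1 + (dd : ℝ) / 2)) := by
    rw [mul_mul_mul_comm, h1, h1']
  have htr := (hMw x (le_trans (le_max_left _ _) (le_trans (le_max_right _ _) hM))) y y'
  have hk0 : 0 ≤ (siteKernelOfOpNu x.toKIdx (bg9Y 𝔸 G x) (fun U => U) (nuY dd x.toKIdx) (T x)).ker (bg9Y 𝔸 G x).one y y' :=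
    siteKernelOfOpNu_ker_nonneg x.toKIdx (bg9Y 𝔸 G x) (fun U => U) (nuY dd x.toKIdx) (T x) (fun z => (nuY_pos dd x.toKIdx z).le) _ y y'
  rw [abs_of_nonneg hk0]
  have hexp : Real.exp (δ₄ / 2 * (geo9Y x).dist y y') * Real.exp (-(δ₄ * (geo9Y x).dist y y')) =
      Real.exp (-(δ₄ / 2 * (geo9Y x).dist y y')) := by
    rw [← Real.exp_add]; congr 1; ring
  calc (siteKernelOfOpNu x.toKIdx (bg9Y 𝔸 G x) (fun U => U) (nuY dd x.toKIdx) (T x)).ker (bg9Y 𝔸 G x).one y y'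
      ≤ nuY dd x.toKIdx y * nuY dd x.toKIdx y' * ((lamY x.toKIdx y)⁻¹ * (lamY x.toKIdx y')⁻¹) *
          (2 / γ₀ * Real.exp (-(δ₄ * (geo9Y x).dist y y'))) := by rw [mul_assoc]; exact hker
    _ = (geo9Y x).len y ^ (-(1 + (dd : ℝ) / 2)) * (geo9Y x).len y' ^ (-(1 + (dd : ℝ) / 2)) *
          (2 / γ₀ * Real.exp (-(δ₄ * (geo9Y x).dist y y'))) := by rw [hww]
    _ ≤ A * Real.exp (δ₄ / 2 * (geo9Y x).dist y y') * (geo9Y x).len y ^ (-(2 : ℝ)) * (geo9Y x).len y' ^ (-(dd : ℝ)) *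
          (2 / γ₀ * Real.exp (-(δ₄ * (geo9Y x).dist y y'))) :=
        mul_le_mul_of_nonneg_right htr (by positivity)
    _ = 2 / γ₀ * A * (geo9Y x).len y ^ (-(2 : ℝ)) * (geo9Y x).len y' ^ (-(dd : ℝ)) * Real.exp (-(δ₄ / 2 * (geo9Y x).dist y y')) := by
        rw [← hexp]; ring

end AtOne

/-! ## §6 ★★★ At the repaired instance of record `opsYNuOfRecordV4E`: both row-26 inequalities at `U = 1` -/

section RecordNuOne

open scoped Matrix.Norms.L2Operator
open B7Prop2SpecialUnitary (specialUnitaryUnits)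
open B9Eq3132SectDLetters (QGQinvY_one_liftEndY)

variable {N : ℕ}

/-- ★★★ **AT `U = 1` BOTH ROW-26 INEQUALITIES OF THE `ν`-READ v4 RECORD ARE THEOREMS** (every `θ` with `4 ≤ θ.ℓ₆`, every `𝔯`, `𝔈`): there are `M₆`, `C > 0`,
`δ > 0` with `B9.Ineq3132 (d+1) (ops x).QGQinv C δ 1 ∧ B9.Ineq3132 (d+1) (ops x).QG1Qinv C δ 1` for every member above `M₆` — [B9] Cor. 3.5's
«for U = 1 proved in [4]» for row 26, at last in the tree ([4] Prop. 2.7, `prop27_kLevel_unconditional`; `(QG₁Q*)⁻¹(1) = (QGQ*)⁻¹(1)`, def-Y `QG1QinvY_one`).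
[cite: Balaban1985BackgroundPropagators, (3.132) p.422, Cor. 3.5 p.407; Balaban1984PropagatorsII, Prop. 2.7 (2.149) p.249] -/
theorem ineq3132Nu_opsYNuOfRecordV4E_one [NeZero N] (θ : Stage3Params) (hℓ : 4 ≤ θ.ℓ₆) (Mstar : ℕ) (𝔯 : ResY N θ Mstar) (𝔢 : SectEY N θ Mstar)
    (𝔴 : RWEY N θ Mstar) (𝔈 : ExpsY N θ Mstar) :
    ∃ M₆ C δ : ℝ, 0 < C ∧ 0 < δ ∧ ∀ x : MemberY θ.d₆ θ.ℓ₆ θ.hd' θ.hL' θ.b₀ θ.b₁ Mstar, M₆ ≤ (geo9Y x).M →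
      B9.Ineq3132 (θ.d₆ + 1) (opsYNuOfRecordV4E N θ Mstar 𝔯 𝔢 𝔴 𝔈 x).QGQinv C δ
          (bg9Y (Matrix (Fin N) (Fin N) ℂ) (specialUnitaryUnits (Fin N)) x).one ∧
        B9.Ineq3132 (θ.d₆ + 1) (opsYNuOfRecordV4E N θ Mstar 𝔯 𝔢 𝔴 𝔈 x).QG1Qinv C δ
          (bg9Y (Matrix (Fin N) (Fin N) ℂ) (specialUnitaryUnits (Fin N)) x).one := by
  have h1 : ∀ x : MemberY θ.d₆ θ.ℓ₆ θ.hd' θ.hL' θ.b₀ θ.b₁ Mstar,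
      (lettersYOfRecordV4 N θ Mstar 𝔯 x).QGQinv (fun _ _ => 1) =
        liftEndY (Matrix (Fin N) (Fin N) ℂ) (onFun (EE (domT x.hN x.D x.hk) x.hcf x.hw)) := fun x =>
    QGQinvY_one_liftEndY x.toKIdx (lettersYOfRecordV4 N θ Mstar 𝔯 x).parS_one (lettersYOfRecordV4 N θ Mstar 𝔯 x).parB_one
      (lettersYOfRecordV4 N θ Mstar 𝔯 x).Gp_one
  have h1' : ∀ x : MemberY θ.d₆ θ.ℓ₆ θ.hd' θ.hL' θ.b₀ θ.b₁ Mstar,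
      (lettersYOfRecordV4 N θ Mstar 𝔯 x).QG1Qinv (fun _ _ => 1) =
        liftEndY (Matrix (Fin N) (Fin N) ℂ) (onFun (EE (domT x.hN x.D x.hk) x.hcf x.hw)) := fun x => by
    rw [← h1 x]
    exact QG1QinvY_one x.toKIdx _ _ _ (𝔯 x).Δ2_one
  obtain ⟨M₆, C, δ, hC, hδ, H⟩ := ineq3132Nu_one (specialUnitaryUnits (Fin N)) hℓ θ.hb.1 θ.hb.2 (θ.d₆ + 1)
    (fun x => (lettersYOfRecordV4 N θ Mstar 𝔯 x).QGQinv) h1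
  obtain ⟨M₆', C', δ', hC', hδ', H'⟩ := ineq3132Nu_one (specialUnitaryUnits (Fin N)) hℓ θ.hb.1 θ.hb.2 (θ.d₆ + 1)
    (fun x => (lettersYOfRecordV4 N θ Mstar 𝔯 x).QG1Qinv) h1'
  refine ⟨max M₆ M₆', max C C', min δ δ', lt_max_of_lt_left hC, lt_min hδ hδ', fun x hM => ⟨?_, ?_⟩⟩
  · exact B9Eq3132Whole.ineq3132_mono (θ.d₆ + 1) (fun y => (geo9Y_len_pos x y).le)
      (fun y y' => B9GeoNormsKLevelV1.geo9K_dist_nonneg x.toKIdx y y') (H x (le_trans (le_max_left _ _) hM))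
      (le_max_left _ _) (le_trans hC.le (le_max_left _ _)) (min_le_left _ _)
  · exact B9Eq3132Whole.ineq3132_mono (θ.d₆ + 1) (fun y => (geo9Y_len_pos x y).le)
      (fun y y' => B9GeoNormsKLevelV1.geo9K_dist_nonneg x.toKIdx y y') (H' x (le_trans (le_max_right _ _) hM))
      (le_max_right _ _) (le_trans hC.le (le_max_left _ _)) (min_le_right _ _)

end RecordNuOne

end

end Literature.MathematicalPhysics.QuantumFieldTheory.Balaban1983to89.B9Eq3132NuReadingAtOne
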